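import Literature.AlgebraicGeometry.Dimension.SmoothRelativeDimensionOfClosedPoints
import Literature.AlgebraicGeometry.Resolution.SmoothStalksRegular
import HarnessLib

/-!
# The Zariski cotangent dimension of a smooth scheme over a field at a point of an open piece of pure relative
# dimension `d` is `d`

Topic `AlgebraicGeometry/Dimension`; namespace `Literature.AlgebraicGeometry.Dimension`.  Mathlib-grade glue over ★
[StacksProject, Tag 056S] (`Resolution.isRegularLocalRing_stalk_of_smooth_of_field`: stalks of a smooth scheme over a field are
regular) and ★ [GortzWedhorn2020] Thm. 6.28 (vi) (`ringKrullDim_stalk_eq_of_smoothOfRelativeDimension_of_isClosed`: at a closed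
point of a scheme smooth of relative dimension `n` over a field, `dim 𝒪_{X,x} = n`), transported along the stalk isomorphism of an
open immersion.  For a smooth `K`-scheme `f : X ⟶ Spec K` of NON-CONSTANT relative dimension (e.g. a fine moduli scheme whose
equidimensionality is in question) this is the honest replacement of «`dim T_x X = rel. dim`»: the tangent dimension at the image of
a closed point of an open piece `ι : S′ ⟶ X` with `ι ≫ f` smooth of relative dimension `d` is `d` — and every point lies on such a
piece (Mathlib `Smooth.exists_isStandardSmooth`, via ★ `Motives.exists_opens_smoothOfRelativeDimension_of_smooth`).  Consumer (cell
hodgecm-mathlib, E-road «EQUIDIM by proof», skeleton `EquidimOfF` v1.1): the piece-currency reduction of the tangent count of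
`𝓐_{g,δ,N} ⊗ ℂ` (`tdim_eq_of_openPiece`).  Theorems only; no definition, no instance, no `sorry`.

## References
* [GortzWedhorn2020] U. Görtz, T. Wedhorn, *Algebraic Geometry I* (2nd ed., 2020): Thm. 6.28 (vi), Prop. 6.15 (1), Lemma 6.26.
* [StacksProject] The Stacks Project, Tag 056S (Lemma 33.25.3: a scheme smooth over a field is regular).
-/

noncomputable section

universe u

open CategoryTheory CategoryTheory.Limits AlgebraicGeometry TopologicalSpace IsLocalRing

namespace Literature.AlgebraicGeometry.Dimension

variable {K : Type u} [Field K] {X S' : Scheme.{u}} (f : X ⟶ Spec (CommRingCat.of K))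

/-- **The Zariski cotangent dimension of a smooth `K`-scheme at the image of a closed point of an open piece smooth of
relative dimension `d` is `d`**: `𝒪_{X,ι y}` is regular (smooth over a field, [StacksProject, Tag 056S]), so
`dim_{κ} 𝔪/𝔪² = dim 𝒪_{X,ι y} = dim 𝒪_{S',y} = d`. [cite: GortzWedhorn2020, Thm. 6.28 (vi)] [cite: StacksProject, Tag 056S] -/
theorem finrank_cotangentSpace_stalk_eq_of_isOpenImmersion_of_isClosed [Smooth f] (ι : S' ⟶ X) [IsOpenImmersion ι]
    (d : ℕ) [SmoothOfRelativeDimension d (ι ≫ f)] {y : S'} (hy : IsClosed ({y} : Set S')) :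
    (Module.finrank (ResidueField (X.presheaf.stalk (ι.base y))) (CotangentSpace (X.presheaf.stalk (ι.base y))) :
      WithBot ℕ∞) = d := by
  haveI := Literature.AlgebraicGeometry.Resolution.isRegularLocalRing_stalk_of_smooth_of_field f (ι.base y)
  rw [(IsRegularLocalRing.iff_finrank_cotangentSpace _).mp this]
  haveI : IsIso (ι.stalkMap y) := (IsOpenImmersion.iff_isIso_stalkMap.mp inferInstance).2 y
  rw [ringKrullDim_eq_of_ringEquiv (asIso (ι.stalkMap y)).commRingCatIsoToRingEquiv]
  exact ringKrullDim_stalk_eq_of_smoothOfRelativeDimension_of_isClosed (ι ≫ f) d hy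

/-- `ℕ`-valued form of `finrank_cotangentSpace_stalk_eq_of_isOpenImmersion_of_isClosed`. [cite: GortzWedhorn2020, Thm. 6.28 (vi)] -/
theorem finrank_cotangentSpace_stalk_eq_of_isOpenImmersion_of_isClosed' [Smooth f] (ι : S' ⟶ X) [IsOpenImmersion ι]
    (d : ℕ) [SmoothOfRelativeDimension d (ι ≫ f)] {y : S'} (hy : IsClosed ({y} : Set S')) :
    Module.finrank (ResidueField (X.presheaf.stalk (ι.base y))) (CotangentSpace (X.presheaf.stalk (ι.base y))) = d := by
  have h := finrank_cotangentSpace_stalk_eq_of_isOpenImmersion_of_isClosed f ι d hy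
  exact_mod_cast h

end Literature.AlgebraicGeometry.Dimension

end
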